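import Literature.NumberTheory.EllipticCurves.Rubin1991.TwoVariableMainConjecture
import Literature.RingTheory.PowerSeries.WeierstrassEvaluationAtMaximal
import HarnessLib

/-!
# Route `SignedLowerHalves`, crux L `SmallImageLowerHalfBothSigns` (stmt-BirchSwinnertonDyer-23599), line `rtt_w3` v13 — E2, row D2 first kernel target
# (BRIEF-E2 rev 2.1 §6, `Lines/rtt_w3-BRIEF-E2-g8.md`), LEAD: THE TWIST SPECIALISATION `Λ₂ → Λ` EXISTS, IS ONTO, AND HAS PRINCIPAL KERNEL `((1+T₂) − u)`

WHY: under the LEAD's architecture ruling (§6) the global carrier of the E2 glue is the SPECIALISATION of the tree's two-variable Iwasawa data (JLK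
`TwistedIwasawaData` over `Λ₂ = ℤ_p⟦T₂⟧⟦T₁⟧ = IwasawaAlgebra₂ p`) to the `θ`-line: along the ring map `φ_u : Λ₂ → Λ = ℤ_p⟦T₁⟧` killing `(1+T₂) − u`
(`u = κ′(γ₂) ≡ 1 (mod p)`; crux idea «detdescent» schema `TwistSpecialisation`). This file CONSTRUCTS such a map for every `u ≡ 1 (mod 𝔪)` — generically over any
local ring `A`: the inner-variable evaluation `A⟦X⟧⟦T⟧ → A⟦T⟧` at `b = u − 1 ∈ 𝔪` (coefficientwise `maxEvalHom`, Weierstrass division by the degree-one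
distinguished `X − b` in the `𝔪`-adically complete local ring `A`, tree `Literature.RingTheory.PowerSeries.WeierstrassEvaluationAtMaximal`) — proves it is surjective, identity on the outer variable and on
constants, and that its kernel is the PRINCIPAL ideal generated by `C (X − C b) = (1 + T₂) − u` (the height-one prime of the descent; `Λ₂/((1+T₂) − u) ≅ Λ`).
THEOREMS ONLY (no definition: the map is produced existentially with its defining clauses); nothing about `BirchSwinnertonDyer`, crux L or E2 is proved here.
[cite: Washington1997, §7.1 Prop. 7.2] [cite: JohnsonLeungKings2011, §4.1–§4.2, Cor. 5.3] [cite: Rubin1991, §4]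
-/

set_option linter.dupNamespace false -- D-0017: single-problem summit, the namespace repeats the problem name by design

noncomputable section

open scoped Classical

namespace Summit.BirchSwinnertonDyer.BirchSwinnertonDyer.Theorems.SmallImageCharSignedSelmer

open PowerSeries Literature.RingTheory.PowerSeries Literature.NumberTheory.EllipticCurves

/-! ## §1 Inner evaluation `A⟦X⟧⟦T⟧ → A⟦T⟧` at a point of the maximal ideal -/

section Inner

variable {A : Type*} [CommRing A] [IsLocalRing A] [IsAdicComplete (IsLocalRing.maximalIdeal A) A] {b : A}
  (hb : b ∈ IsLocalRing.maximalIdeal A)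

omit [IsLocalRing A] [IsAdicComplete (IsLocalRing.maximalIdeal A) A] in
/-- **Divisibility by a constant `C a` in `A⟦X⟧⟦T⟧` is coefficientwise divisibility by `a`.** [folklore] -/
theorem C_dvd_iff_forall_coeff (a : PowerSeries A) (g : PowerSeries (PowerSeries A)) :
    C a ∣ g ↔ ∀ n : ℕ, a ∣ coeff n g := by
  constructor
  · rintro ⟨h, rfl⟩ n
    exact ⟨coeff n h, by rw [coeff_C_mul]⟩
  · intro h
    choose q hq using h
    refine ⟨PowerSeries.mk q, PowerSeries.ext fun n ↦ ?_⟩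
    rw [coeff_C_mul, coeff_mk, ← hq n]

include hb in
/-- ★ **The inner evaluation at `b ∈ 𝔪`.** There is a ring map `φ : A⟦X⟧⟦T⟧ →+* A⟦T⟧` with `φ (C (C a)) = C a`, `φ (C X) = C b`, `φ T = T`, which is surjective and
whose kernel is the principal ideal generated by `C (X − C b)`. [cite: Washington1997, §7.1 Prop. 7.2] -/
theorem exists_innerEval :
    ∃ φ : PowerSeries (PowerSeries A) →+* PowerSeries A,
      (∀ a : A, φ (C (C a)) = C a) ∧ φ (C X) = C b ∧ φ X = X ∧ Function.Surjective φ ∧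
        RingHom.ker φ = Ideal.span {C (X - C b)} := by
  refine ⟨PowerSeries.map (maxEvalHom hb), fun a ↦ ?_, ?_, map_X _, fun g ↦ ?_, ?_⟩
  · rw [map_C, maxEvalHom_apply, maxEval_C]
  · rw [map_C, maxEvalHom_apply, maxEval_X]
  · refine ⟨PowerSeries.map (C : A →+* PowerSeries A) g, ?_⟩
    rw [← RingHom.comp_apply, ← PowerSeries.map_comp]
    have hid : (maxEvalHom hb).comp (C : A →+* PowerSeries A) = RingHom.id A := RingHom.ext fun a ↦ by
      rw [RingHom.comp_apply, maxEvalHom_apply, maxEval_C, RingHom.id_apply]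
    rw [hid, PowerSeries.map_id]
    rfl
  · ext g
    rw [RingHom.mem_ker, Ideal.mem_span_singleton, C_dvd_iff_forall_coeff, PowerSeries.ext_iff]
    refine forall_congr' fun n ↦ ?_
    rw [coeff_map, map_zero, maxEvalHom_apply, X_sub_C_dvd_iff_maxEval_eq_zero hb]

end Inner

/-! ## §2 The twist specialisation `Λ₂ → Λ` of the `θ`-line -/

section Twist

variable {p : ℕ} [Fact p.Prime]

/-- ★★ **The twist specialisation exists.** For every `u ∈ ℤ_p` with `u − 1 ∈ 𝔪 = (p)` there is a SURJECTIVE ring map `φ_u : Λ₂ = ℤ_p⟦T₂⟧⟦T₁⟧ → Λ = ℤ_p⟦T₁⟧` with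
`φ_u ((1 + T₂) − u) = 0` (the two clauses of «detdescent»'s `TwistSpecialisation p φ_u u`, `T₂ = C X` the inner variable as in JLK's `IwasawaCohomologyData` (P6)),
`φ_u T₁ = T₁`, `φ_u` the identity on constants, and `ker φ_u = ((1 + T₂) − u)` PRINCIPAL — so `Λ₂/((1+T₂) − u) ≅ Λ`. [cite: JohnsonLeungKings2011, §4.2 Def. 4.2, Cor. 5.3]
[cite: Washington1997, §7.1 Prop. 7.2] -/
theorem exists_twistSpecialisation (u : ℤ_[p]) (hu : u - 1 ∈ IsLocalRing.maximalIdeal ℤ_[p]) :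
    ∃ φ : IwasawaAlgebra₂ p →+* IwasawaAlgebra p,
      φ (1 + (C (X : IwasawaAlgebra p) : IwasawaAlgebra₂ p) - C (C u)) = 0 ∧ Function.Surjective φ ∧
        (∀ a : ℤ_[p], φ (C (C a)) = C a) ∧ φ X = X ∧
        RingHom.ker φ = Ideal.span {1 + (C (X : IwasawaAlgebra p) : IwasawaAlgebra₂ p) - C (C u)} := by
  obtain ⟨φ, hC, hCX, hX, hsurj, hker⟩ := exists_innerEval (A := ℤ_[p]) hu
  have hgen : (1 + (C (X : IwasawaAlgebra p) : IwasawaAlgebra₂ p) - C (C u)) = C (X - C (u - 1)) := by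
    rw [map_sub, map_sub, map_sub, map_one, map_one]
    ring
  refine ⟨φ, ?_, hsurj, hC, hX, by rw [hgen, hker]⟩
  rw [hgen, ← RingHom.mem_ker, hker]
  exact Ideal.mem_span_singleton_self _

end Twist

end Summit.BirchSwinnertonDyer.BirchSwinnertonDyer.Theorems.SmallImageCharSignedSelmer

end
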